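import Summits.AtomisticToContinuum.HydrodynamicLimit.Theses.JParityClosure
import Literature.Analysis.FluidPDE.SphereMeasureSymmetry

/-!
# The Enskog side of `EvenStressEnskog` is a quadratic form of the relative velocity (moment form)

Structural (negative-side) knowledge for the crux `JParityClosure.EvenStressEnskog` (stmt-AtomisticToContinuum-13079),
from the standing disprover's `Cruxes/EvenStressEnskog/Disproof.lean` §10–§11 (cycle 2). All expressions are VERBATIM
the `let`-bodies of the crux (`Θ`, `B`, `bx`, `ΞP`).

* `sphereMarkP_eq_half` — by the antipodal symmetry of the sphere measure,
  `Θ(Ξ_P^{kl})(v,w) = ∫ ((w−v)·ω)₊ ω_kω_l ((w−v)·ω)₊ dω = ½ ∫ ((w−v)·ω)² ω_k ω_l dω`: an honest QUADRATIC FORM of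
  `w − v` — Galilei invariant (`sphereMarkP_galilei`), symmetric under `v ↔ w` (`sphereMarkP_symm`), homogeneous of
  degree two (`sphereMarkP_smul`);
* `integral_prod_empiricalMeasure` — `∫ F d(μ_z ⊗ μ_z) = (N+1)⁻² Σ_i Σ_j F(z_i, z_j)` (diagonal included);
* `pairFunctionalP_eq_moment` — hence the Enskog pair functional of the crux is
  `B_r(Ξ_P^{kl})(x₀) = (N+1)⁻² ∫ [S₀ S₂(ω) − S₁(ω)²] ω_kω_l dω` with `S₀ = Σ_i b_r(x_i,x₀)`,
  `S₁(ω) = Σ_i b_r(x_i,x₀)⟪v_i,ω⟫`, `S₂(ω) = Σ_i b_r(x_i,x₀)⟪v_i,ω⟫²`: it reads the local velocity law ONLY through its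
  zeroth, first and second moments (a directional velocity VARIANCE, `S₀S₂ − S₁² ≥ 0`).

Consequences recorded in the Disproof: no counterexample to the crux can come from a non-Maxwellian one-body law with
Maxwellian second moments — only the pair CORRELATION at contact can break it; and the trace mark of
`Negative/FrequencyLawReduction.lean` measures the IMPULSE rate (collisional virial), not the bare collision count.
refuter-cdisprove-stmt-AtomisticToContinuum-13079-g2-0.
-/

noncomputable section

namespace Summit.AtomisticToContinuum.HydrodynamicLimit.Theorems

open MeasureTheory Filter Set
open scoped ENNReal InnerProductSpace
open Literature.MathematicalPhysics.KineticTheory Literature.Analysis.FluidPDE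

namespace EvenStressEnskog

/-- `(a)₊² + (−a)₊² = a²`. [folklore] -/
theorem max_zero_sq_add_max_neg_zero_sq (a : ℝ) : max a 0 ^ 2 + max (-a) 0 ^ 2 = a ^ 2 := by
  rcases le_total 0 a with h | h
  · rw [max_eq_left h, max_eq_right (by linarith), zero_pow two_ne_zero, add_zero]
  · rw [max_eq_right h, max_eq_left (by linarith)]; ring

/-- **Half-quadratic identity** for the sphere-integrated momentum-transfer mark of the crux (verbatim `Θ (ΞP k l) v w`):
`∫ ((w−v)·ω)₊ ω_kω_l · ((w−v)·ω)₊ dω = ½ ∫ ((w−v)·ω)² ω_kω_l dω`. [folklore] -/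
theorem sphereMarkP_eq_half (k l : Fin 3) (v w : V3) :
    ∫ ω : Metric.sphere (0 : V3) 1, max ⟪w - v, ((ω : V3))⟫_ℝ 0 * ((ω : V3) k * (ω : V3) l) *
        hardSphereKernel (w, v) ω ∂sphereMeasure
      = 1 / 2 * ∫ ω : Metric.sphere (0 : V3) 1, ⟪w - v, ((ω : V3))⟫_ℝ ^ 2 * ((ω : V3) k * (ω : V3) l)
        ∂sphereMeasure := by
  set F : Metric.sphere (0 : V3) 1 → ℝ :=
    fun ω => max ⟪w - v, ((ω : V3))⟫_ℝ 0 ^ 2 * ((ω : V3) k * (ω : V3) l) with hFdef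
  have hLHS : ∫ ω : Metric.sphere (0 : V3) 1, max ⟪w - v, ((ω : V3))⟫_ℝ 0 * ((ω : V3) k * (ω : V3) l) *
      hardSphereKernel (w, v) ω ∂sphereMeasure = ∫ ω, F ω ∂sphereMeasure := by
    congr 1; funext ω
    simp only [hFdef, hardSphereKernel]
    ring
  rw [hLHS]
  haveI := Literature.Analysis.FluidPDE.isFiniteMeasure_sphereMeasure (E := V3)
  have hFc : Continuous F := by
    rw [hFdef]
    fun_prop
  have hFi : Integrable F sphereMeasure :=
    hFc.integrable_of_hasCompactSupport (isClosed_tsupport _).isCompact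
  have hFn : ∀ ω : Metric.sphere (0 : V3) 1,
      F (-ω) = max (-⟪w - v, ((ω : V3))⟫_ℝ) 0 ^ 2 * ((ω : V3) k * (ω : V3) l) := by
    intro ω
    simp only [hFdef, coe_neg_sphere, inner_neg_right, PiLp.neg_apply, neg_mul_neg]
  have hFni : Integrable (fun ω => F (-ω)) sphereMeasure :=
    (hFc.comp continuous_neg).integrable_of_hasCompactSupport (isClosed_tsupport _).isCompact
  have hsum : ∀ ω : Metric.sphere (0 : V3) 1,
      F ω + F (-ω) = ⟪w - v, ((ω : V3))⟫_ℝ ^ 2 * ((ω : V3) k * (ω : V3) l) := by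
    intro ω
    rw [hFn]
    simp only [hFdef]
    rw [← add_mul, max_zero_sq_add_max_neg_zero_sq]
  have hneg : ∫ ω, F (-ω) ∂sphereMeasure = ∫ ω, F ω ∂sphereMeasure :=
    Literature.Analysis.FluidPDE.integral_comp_neg_sphere F
  have h2 : ∫ ω, F ω ∂sphereMeasure + ∫ ω, F (-ω) ∂sphereMeasure =
      ∫ ω : Metric.sphere (0 : V3) 1, ⟪w - v, ((ω : V3))⟫_ℝ ^ 2 * ((ω : V3) k * (ω : V3) l)
        ∂sphereMeasure := by
    rw [← integral_add hFi hFni]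
    exact integral_congr_ae (Filter.Eventually.of_forall hsum)
  rw [← h2, hneg]
  ring

/-- **Galilei invariance** of the Enskog side: `Θ(Ξ_P^{kl})` depends on the relative velocity only. [folklore] -/
theorem sphereMarkP_galilei (k l : Fin 3) (v w u : V3) :
    ∫ ω : Metric.sphere (0 : V3) 1, max ⟪(w + u) - (v + u), ((ω : V3))⟫_ℝ 0 * ((ω : V3) k * (ω : V3) l) *
        hardSphereKernel (w + u, v + u) ω ∂sphereMeasure
      = ∫ ω : Metric.sphere (0 : V3) 1, max ⟪w - v, ((ω : V3))⟫_ℝ 0 * ((ω : V3) k * (ω : V3) l) *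
        hardSphereKernel (w, v) ω ∂sphereMeasure := by
  rw [sphereMarkP_eq_half, sphereMarkP_eq_half, add_sub_add_right_eq_sub]

/-- **Swap symmetry** of the Enskog side under `v ↔ w`. [folklore] -/
theorem sphereMarkP_symm (k l : Fin 3) (v w : V3) :
    ∫ ω : Metric.sphere (0 : V3) 1, max ⟪v - w, ((ω : V3))⟫_ℝ 0 * ((ω : V3) k * (ω : V3) l) *
        hardSphereKernel (v, w) ω ∂sphereMeasure
      = ∫ ω : Metric.sphere (0 : V3) 1, max ⟪w - v, ((ω : V3))⟫_ℝ 0 * ((ω : V3) k * (ω : V3) l) *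
        hardSphereKernel (w, v) ω ∂sphereMeasure := by
  rw [sphereMarkP_eq_half, sphereMarkP_eq_half]
  congr 1
  refine integral_congr_ae (Filter.Eventually.of_forall fun ω => ?_)
  simp only
  rw [← neg_sub w v, inner_neg_left, neg_sq]

/-- **Degree-two homogeneity** of the Enskog side under `v ↦ cv` (kinematic scale covariance). [folklore] -/
theorem sphereMarkP_smul (k l : Fin 3) (c : ℝ) (v w : V3) :
    ∫ ω : Metric.sphere (0 : V3) 1, max ⟪c • w - c • v, ((ω : V3))⟫_ℝ 0 * ((ω : V3) k * (ω : V3) l) *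
        hardSphereKernel (c • w, c • v) ω ∂sphereMeasure
      = c ^ 2 * ∫ ω : Metric.sphere (0 : V3) 1, max ⟪w - v, ((ω : V3))⟫_ℝ 0 * ((ω : V3) k * (ω : V3) l) *
        hardSphereKernel (w, v) ω ∂sphereMeasure := by
  rw [sphereMarkP_eq_half, sphereMarkP_eq_half, ← smul_sub c w v]
  rw [show c ^ 2 * (1 / 2 * ∫ ω : Metric.sphere (0 : V3) 1,
        ⟪w - v, ((ω : V3))⟫_ℝ ^ 2 * ((ω : V3) k * (ω : V3) l) ∂sphereMeasure)
      = 1 / 2 * ∫ ω : Metric.sphere (0 : V3) 1,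
        c ^ 2 * (⟪w - v, ((ω : V3))⟫_ℝ ^ 2 * ((ω : V3) k * (ω : V3) l)) ∂sphereMeasure by
    rw [integral_const_mul]; ring]
  congr 1
  refine integral_congr_ae (Filter.Eventually.of_forall fun ω => ?_)
  simp only
  rw [real_inner_smul_left]
  ring

/-- The product of two empirical measures is the normalised sum of the pair Dirac masses. [folklore] -/
theorem empiricalMeasure_prod_eq {N : ℕ} (z : Config (N + 1) (Fin 3) T3) :
    (empiricalMeasure z).prod (empiricalMeasure z) =
      (((N + 1 : ℕ) : ℝ≥0∞)⁻¹ * ((N + 1 : ℕ) : ℝ≥0∞)⁻¹) •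
        Measure.sum (fun p : Fin (N + 1) × Fin (N + 1) => Measure.dirac (z p.1, z p.2)) := by
  rw [empiricalMeasure_eq, ← Measure.sum_fintype, Measure.prod_smul_left, Measure.prod_smul_right,
    smul_smul, Measure.prod_sum]
  congr 1
  congr 1
  funext p
  exact Measure.dirac_prod_dirac

/-- **Integration against the product of empirical measures** is the normalised double sum
`∫ F d(μ_z ⊗ μ_z) = (N+1)⁻² Σ_i Σ_j F(z_i, z_j)` (diagonal included). [folklore] -/
theorem integral_prod_empiricalMeasure {N : ℕ} (z : Config (N + 1) (Fin 3) T3)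
    (F : (T3 × V3) × (T3 × V3) → ℝ) :
    ∫ p, F p ∂((empiricalMeasure z).prod (empiricalMeasure z)) =
      ((N + 1 : ℕ) : ℝ)⁻¹ * ((N + 1 : ℕ) : ℝ)⁻¹ * ∑ i, ∑ j, F (z i, z j) := by
  haveI : MeasurableSingletonClass ((T3 × V3) × (T3 × V3)) := Prod.instMeasurableSingletonClass
  rw [empiricalMeasure_prod_eq, integral_smul_measure, Measure.sum_fintype,
    integral_finsetSum_measure fun p _ => integrable_dirac (by simp)]
  simp only [integral_dirac, smul_eq_mul, ENNReal.toReal_mul, ENNReal.toReal_inv,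
    ENNReal.toReal_natCast, Fintype.sum_prod_type]

/-- The weighted double-sum identity `Σ_i Σ_j b_i b_j (p_j − p_i)² = 2 (S₀ Σ_i b_i p_i² − (Σ_i b_i p_i)²)`. [folklore] -/
theorem sum_sum_mul_mul_sq_sub {n : ℕ} (b p : Fin n → ℝ) :
    ∑ i, ∑ j, b i * b j * (p j - p i) ^ 2 =
      2 * ((∑ i, b i) * (∑ i, b i * p i ^ 2) - (∑ i, b i * p i) ^ 2) := by
  have hA : ∑ i, ∑ j, b i * (b j * p j ^ 2) = (∑ i, b i) * (∑ j, b j * p j ^ 2) := by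
    rw [Finset.sum_mul_sum]
  have hA' : ∑ i, ∑ j, b i * p i ^ 2 * b j = (∑ i, b i) * (∑ j, b j * p j ^ 2) := by
    rw [Finset.sum_comm, Finset.sum_mul_sum]
    exact Finset.sum_congr rfl fun i _ => Finset.sum_congr rfl fun j _ => by ring
  have hC : ∑ i, ∑ j, b i * p i * (b j * p j) = (∑ i, b i * p i) ^ 2 := by
    rw [sq, Finset.sum_mul_sum]
  calc ∑ i, ∑ j, b i * b j * (p j - p i) ^ 2
      = ∑ i, ∑ j, (b i * (b j * p j ^ 2) + b i * p i ^ 2 * b j - 2 * (b i * p i * (b j * p j))) :=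
        Finset.sum_congr rfl fun i _ => Finset.sum_congr rfl fun j _ => by ring
    _ = ∑ i, ∑ j, b i * (b j * p j ^ 2) + ∑ i, ∑ j, b i * p i ^ 2 * b j
          - 2 * ∑ i, ∑ j, b i * p i * (b j * p j) := by
        simp only [Finset.sum_add_distrib, Finset.sum_sub_distrib, Finset.mul_sum]
    _ = _ := by rw [hA, hA', hC]; ring

/-- **Moment form of the Enskog pair functional of the crux** (verbatim `B (ΞP k l) z s x₀` at a fixed configuration):
`B_r(Ξ_P^{kl})(x₀) = (N+1)⁻² ∫ [S₀·S₂(ω) − S₁(ω)²] ω_kω_l dω`, `S₀ = Σ_i b_r(x_i,x₀)`, `S₁(ω) = Σ_i b_r(x_i,x₀)⟪v_i,ω⟫`,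
`S₂(ω) = Σ_i b_r(x_i,x₀)⟪v_i,ω⟫²` — an explicit functional of the local zeroth, first and second velocity moments
only. [folklore] -/
theorem pairFunctionalP_eq_moment {N : ℕ} (k l : Fin 3) (r : ℝ) (z : Config (N + 1) (Fin 3) T3) (x₀ : T3) :
    ∫ p, 3 / (Real.pi * r ^ 3) * max (1 - Torus.euclidDist p.1.1 x₀ / r) 0 *
        (3 / (Real.pi * r ^ 3) * max (1 - Torus.euclidDist p.2.1 x₀ / r) 0) *
        ∫ ω : Metric.sphere (0 : V3) 1, max ⟪p.2.2 - p.1.2, ((ω : V3))⟫_ℝ 0 * ((ω : V3) k * (ω : V3) l) *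
          hardSphereKernel (p.2.2, p.1.2) ω ∂sphereMeasure
      ∂((empiricalMeasure z).prod (empiricalMeasure z))
    = ((N + 1 : ℕ) : ℝ)⁻¹ * ((N + 1 : ℕ) : ℝ)⁻¹ *
      ∫ ω : Metric.sphere (0 : V3) 1,
        ((∑ i, 3 / (Real.pi * r ^ 3) * max (1 - Torus.euclidDist (z i).1 x₀ / r) 0) *
            (∑ i, 3 / (Real.pi * r ^ 3) * max (1 - Torus.euclidDist (z i).1 x₀ / r) 0 *
              ⟪(z i).2, ((ω : V3))⟫_ℝ ^ 2) -
          (∑ i, 3 / (Real.pi * r ^ 3) * max (1 - Torus.euclidDist (z i).1 x₀ / r) 0 *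
              ⟪(z i).2, ((ω : V3))⟫_ℝ) ^ 2) *
        ((ω : V3) k * (ω : V3) l) ∂sphereMeasure := by
  rw [integral_prod_empiricalMeasure]
  congr 1
  simp only
  set b : Fin (N + 1) → ℝ := fun i => 3 / (Real.pi * r ^ 3) * max (1 - Torus.euclidDist (z i).1 x₀ / r) 0
    with hb
  haveI := Literature.Analysis.FluidPDE.isFiniteMeasure_sphereMeasure (E := V3)
  set G : Fin (N + 1) → Fin (N + 1) → Metric.sphere (0 : V3) 1 → ℝ := fun i j ω =>
    b i * b j / 2 * (⟪(z j).2 - (z i).2, ((ω : V3))⟫_ℝ ^ 2 * ((ω : V3) k * (ω : V3) l)) with hG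
  have hGi : ∀ i j, Integrable (G i j) sphereMeasure := by
    intro i j
    have hc : Continuous (G i j) := by rw [hG]; fun_prop
    exact hc.integrable_of_hasCompactSupport (isClosed_tsupport _).isCompact
  have h1 : ∀ i j, b i * b j *
      ∫ ω : Metric.sphere (0 : V3) 1, max ⟪(z j).2 - (z i).2, ((ω : V3))⟫_ℝ 0 * ((ω : V3) k * (ω : V3) l) *
          hardSphereKernel ((z j).2, (z i).2) ω ∂sphereMeasure =
      ∫ ω, G i j ω ∂sphereMeasure := by
    intro i j
    rw [sphereMarkP_eq_half, ← mul_assoc, ← integral_const_mul]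
    congr 1
    funext ω
    simp only [hG]
    ring
  have h1' : ∀ i j, 3 / (Real.pi * r ^ 3) * max (1 - Torus.euclidDist (z i).1 x₀ / r) 0 *
        (3 / (Real.pi * r ^ 3) * max (1 - Torus.euclidDist (z j).1 x₀ / r) 0) *
      ∫ ω : Metric.sphere (0 : V3) 1, max ⟪(z j).2 - (z i).2, ((ω : V3))⟫_ℝ 0 * ((ω : V3) k * (ω : V3) l) *
          hardSphereKernel ((z j).2, (z i).2) ω ∂sphereMeasure =
      ∫ ω, G i j ω ∂sphereMeasure := fun i j => h1 i j
  simp_rw [h1']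
  have h2 : ∀ i, ∑ j, ∫ ω, G i j ω ∂sphereMeasure = ∫ ω, ∑ j, G i j ω ∂sphereMeasure := fun i =>
    (integral_finsetSum _ (fun j _ => hGi i j)).symm
  simp_rw [h2]
  rw [← integral_finsetSum _ (fun i _ => integrable_finsetSum _ (fun j _ => hGi i j))]
  congr 1
  funext ω
  have h3 : ∀ i j, G i j ω = (ω : V3) k * (ω : V3) l / 2 *
      (b i * b j * (⟪(z j).2, ((ω : V3))⟫_ℝ - ⟪(z i).2, ((ω : V3))⟫_ℝ) ^ 2) := by
    intro i j
    simp only [hG, inner_sub_left]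
    ring
  simp_rw [h3, ← Finset.mul_sum]
  rw [sum_sum_mul_mul_sq_sub b (fun i => ⟪(z i).2, ((ω : V3))⟫_ℝ)]
  ring

end EvenStressEnskog

end Summit.AtomisticToContinuum.HydrodynamicLimit.Theorems

end
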